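/-
Copyright (c) 2026. All rights reserved.
Released under Apache 2.0 license as described in the file LICENSE.
Authors: abc-iut cell — seat abc-iut-w4-d089 (wave 4, gen 9; row «F-1922-AS-TYPED», L3-lead β43 (b)), after the integrated
Thm 5.4 line v6 (p457403), abc-iut-w4-d083's compatible reading and abc-iut-w6-d070's tempered level topologies.
-/
import Literature.AnabelianGeometry.SemiGraphs.ArithThm54IntegratedChartHcontFree
import Literature.AnabelianGeometry.SemiGraphs.ArithQuasiGeometricLiteralReduction
import HarnessLib

/-!
# [SemiAnbd] Thm 5.4 (iii) AS TYPED at the outer models: the frozen LITERAL `ArithQuasiGeometricCorrespondenceStatement`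
# (FACT-LIST F-1922) BY NAME, from the integrated line v6 modulo ONE displayed hypothesis `hdist` (proof-only)

Mochizuki, *Semi-graphs of anabelioids*, Publ. RIMS **42** (2006), §5 Thm 5.4 (iii) p. 66 [cite: MochizukiSemiAnbd2006,
Thm 5.4 (iii), p. 66]: "applying `B^temp(−)` determines a natural bijective correspondence between locally open morphisms
`𝔊 → ℍ` over `A` and arithmetically quasi-geometric morphisms of temperoids `B^temp(𝔊) → B^temp(ℍ)` over `A^⊤`".

PROOF-ONLY file (abc-iut cell, layer L3, T54 board / L-F pack B row F-1922 «AS-TYPED», L3-lead ruling β43 (b); seat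
abc-iut-w4-d089 gen 9).  No definition, no new named fact; statement files untouched.  The integrated line of record v6
(`arithThm54_outerModels_chart_of_producers_anyRepresentatives_hcontFree`, p457403) concludes, at the outer models
`E_𝒢 := π₁^temp(𝒢) ⋊^out Π_A`, `E_ℋ := π₁^temp(ℋ) ⋊^out Π_{A′}` with the canonical `B^temp`, Thm 5.4 (i) ∧ (ii) AS TYPED on
both sides and the COMPATIBLE reading of (iii).  The abstract reduction of this row
(`ArithQuasiGeometricLiteralReduction.lean`: literal ∧ (i) ∧ (ii) pins both verticial images over ONE edge-like pair;
distinctness is exactly the missing datum) turns this into the frozen LITERAL statement (F-1922's decl) modulo ONE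
displayed, print-meaningful hypothesis:

* `arithQuasiGeometricCorrespondenceStatement_outerModels_of_hdist` — under EXACTLY v6's binders (verbatim; representatives
  `Rc′` on the `ℋ′` side only) plus `hdist` ("no LITERALLY arithmetically quasi-geometric `f : E_𝒢 → E_ℋ` over `A^⊤` carries
  two distinct arithmetically maximal compact subgroups of `E_𝒢` with arithmetically ample meet into ONE arithmetically
  maximal compact subgroup of `E_ℋ`"), the frozen `ArithQuasiGeometricCorrespondenceStatement 𝔊 ℍ e aug_𝒢 aug_ℋ B^temp`
  holds at the outer models.  Inputs by name: v6; `E_𝒢` Hausdorff in abc-iut-w6-d070's tempered level topology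
  (`arithLevelTopology_t2Space`); transport of (i)(ii) along `e⁻¹` (`arithMaximalCompactStatementI/II_comp_mulEquiv_iff`,
  `e` an isomorphism of profinite groups); `arithQuasiGeometricCorrespondenceStatement_of_compat_of_hdist`.

HONEST LABEL.  This is a CONDITIONAL closer of F-1922 at the genuine carrier: the residual per side is v6's (module
docstring of `ArithThm54IntegratedChartHcontFree.lean`) and, across, `hdist` — the arithmetic shadow of the COLLAPSE FOLD
(cell finding O-T54-1 / t2g2-F1; geometric kernel precedent `IwahoriWitness.exists_collapseFold`), NOT claimed derivable and
expected FALSE at any Thm-5.4-frame carrier with an edge admitting a `Π_A`-equivariant fold (GAP-LEDGER row G-w4d089-g9-1).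
So the file records precisely what separates the kernel's Thm 5.4 (iii) (compatible reading, v6) from the statement AS
TYPED.  Typed ≠ proved for the residual inputs; nothing here bears on [IUTchIII] Cor. 3.12.
-/

namespace Literature.AnabelianGeometry.SemiGraphs

open _root_.CategoryTheory _root_.Topology _root_.Filter ProfiniteSemiGraph Literature.AnabelianGeometry.EtaleTheta
open scoped Pointwise

universe u v u₀

variable {Obj : Type u} [Category.{v} Obj] {𝓥 : SemiAnbdVocab.{u, v, u₀} Obj}
variable {𝔊 ℍ : ArithSemiGraph 𝓥} {e : 𝔊.PA ≃* ℍ.PA}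
variable {𝒢 ℋ : ProfiniteSemiGraph.{u₀}}

/-- **[SemiAnbd] Thm 5.4 (iii) AS TYPED at the outer models, modulo `hdist`**: the frozen LITERAL
`ArithQuasiGeometricCorrespondenceStatement` (F-1922) for the outer models `π₁^temp(𝒢) ⋊^out Π_A`, `π₁^temp(ℋ) ⋊^out Π_{A′}` and
the canonical `B^temp`, from the integrated line v6 (Thm 5.4 (i) ∧ (ii) on both sides, compatible (iii)) and the reduction
`arithQuasiGeometricCorrespondenceStatement_of_compat_of_hdist`, under v6's binders plus the ONE displayed hypothesis `hdist`
(no literally arithmetically quasi-geometric `f` over `A^⊤` collapses an arithmetically ample pair of distinct arithmetically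
maximal compact subgroups into one).  Residual: module docstring. [cite: MochizukiSemiAnbd2006, Thm 5.4 (iii), p. 66] -/
theorem arithQuasiGeometricCorrespondenceStatement_outerModels_of_hdist
    -- ── the 𝔾 side: a cofinal Galois tower with characteristic levels, its chart, the outer model over `Π_A` ──
    (h39𝒢 : Cor39Hypotheses 𝒢) (D𝒢 : GaloisLevelData 𝒢)
    (hcof𝒢 : ∀ (X : CovObj 𝒢), X.IsTempered → ∀ p : X.Point, ∃ i : ℕ, ∀ j, i ≤ j → (D𝒢.S j).Splits (X.component p))
    (hS𝒢 : ∀ n, (D𝒢.S n).Splits (D𝒢.S n)) (hfin𝒢 : ∀ n, (D𝒢.S n).IsFinite) (hne𝒢 : ∀ n, (D𝒢.S n).HasNonemptyFibres)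
    (hconn𝒢 : ∀ (n : ℕ) (p q : (D𝒢.S n).Point), (D𝒢.S n).SameComponent p q)
    [Finite 𝒢.graph.Vertex] [Finite 𝒢.graph.Branch]
    [Finite 𝒢.graph.Edge]
    (ρ𝒢 : 𝔊.PA →* TopOut (D𝒢.chart h39𝒢.toProp36Hypotheses.isCountable hcof𝒢 h39𝒢.toProp36Hypotheses.isConnected hS𝒢 hfin𝒢 hne𝒢).G) (baseAct𝒢 : 𝔊.PA →* Aut 𝒢.graph)
    [inst𝒢 : TopologicalSpace (outerSemidirectProduct ρ𝒢)]
    (T𝒢 : ∀ w : 𝒢.graph.Vertex, D𝒢.PointSeq h39𝒢.toProp36Hypotheses.isCountable w) (R𝒢 : SemiGraph.RefBranches 𝒢.graph)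
    (Rc𝒢 : ChartRepresentatives (D𝒢.chart h39𝒢.toProp36Hypotheses.isCountable hcof𝒢 h39𝒢.toProp36Hypotheses.isConnected hS𝒢 hfin𝒢 hne𝒢))
    -- Prop 3.6 (iv) at `ρ_𝔾(a)` / Def 5.1 (i)(c): the DESIGN data of the outer model (abc-iut-w4-d082's currency)
    (hV𝒢 : ∀ (a : 𝔊.PA) (v : 𝒢.graph.Vertex) (H : Subgroup (D𝒢.chart h39𝒢.toProp36Hypotheses.isCountable hcof𝒢 h39𝒢.toProp36Hypotheses.isConnected hS𝒢 hfin𝒢 hne𝒢).G), H ∈ verticialSubgroups (D𝒢.chart h39𝒢.toProp36Hypotheses.isCountable hcof𝒢 h39𝒢.toProp36Hypotheses.isConnected hS𝒢 hfin𝒢 hne𝒢) v →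
      ∃ φ : contMulAut (D𝒢.chart h39𝒢.toProp36Hypotheses.isCountable hcof𝒢 h39𝒢.toProp36Hypotheses.isConnected hS𝒢 hfin𝒢 hne𝒢).G, TopOut.mk _ φ = ρ𝒢 a ∧
        H.map (φ : MulAut (D𝒢.chart h39𝒢.toProp36Hypotheses.isCountable hcof𝒢 h39𝒢.toProp36Hypotheses.isConnected hS𝒢 hfin𝒢 hne𝒢).G).toMonoidHom ∈ verticialSubgroups (D𝒢.chart h39𝒢.toProp36Hypotheses.isCountable hcof𝒢 h39𝒢.toProp36Hypotheses.isConnected hS𝒢 hfin𝒢 hne𝒢) ((baseAct𝒢 a).hom.vertexMap v))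
    (hE𝒢 : ∀ (a : 𝔊.PA) (e : 𝒢.graph.Edge) (K : Subgroup (D𝒢.chart h39𝒢.toProp36Hypotheses.isCountable hcof𝒢 h39𝒢.toProp36Hypotheses.isConnected hS𝒢 hfin𝒢 hne𝒢).G), K ∈ edgeLikeSubgroups (D𝒢.chart h39𝒢.toProp36Hypotheses.isCountable hcof𝒢 h39𝒢.toProp36Hypotheses.isConnected hS𝒢 hfin𝒢 hne𝒢) e →
      ∃ φ : contMulAut (D𝒢.chart h39𝒢.toProp36Hypotheses.isCountable hcof𝒢 h39𝒢.toProp36Hypotheses.isConnected hS𝒢 hfin𝒢 hne𝒢).G, TopOut.mk _ φ = ρ𝒢 a ∧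
        K.map (φ : MulAut (D𝒢.chart h39𝒢.toProp36Hypotheses.isCountable hcof𝒢 h39𝒢.toProp36Hypotheses.isConnected hS𝒢 hfin𝒢 hne𝒢).G).toMonoidHom ∈ edgeLikeSubgroups (D𝒢.chart h39𝒢.toProp36Hypotheses.isCountable hcof𝒢 h39𝒢.toProp36Hypotheses.isConnected hS𝒢 hfin𝒢 hne𝒢) ((baseAct𝒢 a).hom.edgeMap e))
    (hopen𝒢 : ∃ U : Subgroup 𝔊.PA, IsOpen (U : Set 𝔊.PA) ∧ ∀ a ∈ U,
      (∀ v, (baseAct𝒢 a).hom.vertexMap v = v) ∧ (∀ e, (baseAct𝒢 a).hom.edgeMap e = e) ∧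
        ∀ b, (baseAct𝒢 a).hom.branchMap b = b)
    (hBR𝒢 : ∀ (a : 𝔊.PA) (b : 𝒢.graph.Branch) (v : 𝒢.graph.Vertex) (hb : 𝒢.graph.abuts b = some v)
      (φ : 𝒢.Gv v →ₜ* (D𝒢.chart h39𝒢.toProp36Hypotheses.isCountable hcof𝒢 h39𝒢.toProp36Hypotheses.isConnected hS𝒢 hfin𝒢 hne𝒢).G), IsVerticialHom (D𝒢.chart h39𝒢.toProp36Hypotheses.isCountable hcof𝒢 h39𝒢.toProp36Hypotheses.isConnected hS𝒢 hfin𝒢 hne𝒢) v φ →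
      ∃ Φ : contMulAut (D𝒢.chart h39𝒢.toProp36Hypotheses.isCountable hcof𝒢 h39𝒢.toProp36Hypotheses.isConnected hS𝒢 hfin𝒢 hne𝒢).G, TopOut.mk _ Φ = ρ𝒢 a ∧
        ∃ φ' : 𝒢.Gv ((baseAct𝒢 a).hom.vertexMap v) →ₜ* (D𝒢.chart h39𝒢.toProp36Hypotheses.isCountable hcof𝒢 h39𝒢.toProp36Hypotheses.isConnected hS𝒢 hfin𝒢 hne𝒢).G,
          IsVerticialHom (D𝒢.chart h39𝒢.toProp36Hypotheses.isCountable hcof𝒢 h39𝒢.toProp36Hypotheses.isConnected hS𝒢 hfin𝒢 hne𝒢) ((baseAct𝒢 a).hom.vertexMap v) φ' ∧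
          ∃ x' : (D𝒢.chart h39𝒢.toProp36Hypotheses.isCountable hcof𝒢 h39𝒢.toProp36Hypotheses.isConnected hS𝒢 hfin𝒢 hne𝒢).G,
            Subgroup.map (Φ : MulAut (D𝒢.chart h39𝒢.toProp36Hypotheses.isCountable hcof𝒢 h39𝒢.toProp36Hypotheses.isConnected hS𝒢 hfin𝒢 hne𝒢).G).toMonoidHom φ.toMonoidHom.range =
              Subgroup.map (MulAut.conj x').toMonoidHom φ'.toMonoidHom.range ∧
            Subgroup.map (Φ : MulAut (D𝒢.chart h39𝒢.toProp36Hypotheses.isCountable hcof𝒢 h39𝒢.toProp36Hypotheses.isConnected hS𝒢 hfin𝒢 hne𝒢).G).toMonoidHom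
                (Subgroup.map φ.toMonoidHom (𝒢.branchSubgroup b v hb)) =
              Subgroup.map (MulAut.conj x').toMonoidHom
                (Subgroup.map φ'.toMonoidHom
                  (𝒢.branchSubgroup ((baseAct𝒢 a).hom.branchMap b) ((baseAct𝒢 a).hom.vertexMap v)
                    ((baseAct𝒢 a).hom.abuts_branchMap b v hb))))
    (w𝒢 : 𝒢.graph.Vertex)
    -- CHARACTERISTIC finite levels (abc-iut-L3-t9 E1): `ker π_n` is the characteristic open core of level `d𝒢 n`
    (d𝒢 : ℕ → ℕ) (hker𝒢 : ∀ n, (D𝒢.piLevelAut h39𝒢.toProp36Hypotheses.isCountable hconn𝒢 n).ker = charOpenCore (D𝒢.temperedPi h39𝒢.toProp36Hypotheses.isCountable) (d𝒢 n))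
    -- (I0v) for the tower `D𝒢`: every `𝒢_v` acts faithfully on the `v`-fibres of the levels (abc-iut-w4-d053's
    -- `faithfulV_ofOpenNormalSeq` at the prescribed open-normal / characteristic tower)
    (hfaithV𝒢 : ∀ (v : 𝒢.graph.Vertex) (h : 𝒢.Gv v),
      (∀ (n : ℕ) (x : ((D𝒢.S n).SV v).obj.V), ((D𝒢.S n).SV v).obj.ρ h x = x) → h = 1)
    -- `hK1′` REPLACED (the L3 lead's α92 wording): congruence-continuity of `ρ` at the deep tree levels with trivial
    -- base action nearby (`hCC`, Def 5.1 (i)(c)/(d) + Prop 5.2 (i)); `hself` DISCHARGED (abc-iut-w6-d117 p442489)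
    (n𝒢 : ℕ)
    (hCC𝒢 : ∀ n, n𝒢 ≤ n → ∃ U ∈ 𝓝 (1 : ↥𝔊.PA), ∀ a ∈ U, baseAct𝒢 a = 1 ∧
      ∃ φ : contMulAut (D𝒢.chart h39𝒢.toProp36Hypotheses.isCountable hcof𝒢 h39𝒢.toProp36Hypotheses.isConnected hS𝒢 hfin𝒢 hne𝒢).G, TopOut.mk (D𝒢.chart h39𝒢.toProp36Hypotheses.isCountable hcof𝒢 h39𝒢.toProp36Hypotheses.isConnected hS𝒢 hfin𝒢 hne𝒢).G φ = ρ𝒢 a ∧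
        ∀ y : (D𝒢.chart h39𝒢.toProp36Hypotheses.isCountable hcof𝒢 h39𝒢.toProp36Hypotheses.isConnected hS𝒢 hfin𝒢 hne𝒢).G, (φ : MulAut (D𝒢.chart h39𝒢.toProp36Hypotheses.isCountable hcof𝒢 h39𝒢.toProp36Hypotheses.isConnected hS𝒢 hfin𝒢 hne𝒢).G) y * y⁻¹ ∈ (D𝒢.projAut h39𝒢.toProp36Hypotheses.isCountable n).ker)
    -- the topology of `E` IS abc-iut-w6-d070's tempered level topology at the chart of the tower
    (hinst𝒢 : inst𝒢 = @arithLevelTopology 𝒢 (D𝒢.chart h39𝒢.toProp36Hypotheses.isCountable hcof𝒢 h39𝒢.toProp36Hypotheses.isConnected hS𝒢 hfin𝒢 hne𝒢) 𝔊.PA _ _ _ ρ𝒢 baseAct𝒢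
        (TemperedPiChart.firstCountableTopology_G (D𝒢.chart h39𝒢.toProp36Hypotheses.isCountable hcof𝒢 h39𝒢.toProp36Hypotheses.isConnected hS𝒢 hfin𝒢 hne𝒢)) h39𝒢.toProp36Hypotheses IsTempered.of_profinite (D𝒢.piPresentation h39𝒢.toProp36Hypotheses.isCountable T𝒢 R𝒢)
        (isArithCompatible_piPresentation_outerAction_of_branchPair_chart_of_finite D𝒢 h39𝒢.toProp36Hypotheses.isCountable hcof𝒢 h39𝒢.toProp36Hypotheses.isConnected hS𝒢 hfin𝒢 hne𝒢 T𝒢 R𝒢 ρ𝒢 baseAct𝒢 h39𝒢.thm37Hypotheses h39𝒢.isGraph hV𝒢 hBR𝒢) w𝒢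
        (D𝒢.isCompact_piPresentation_H h39𝒢.toProp36Hypotheses.isCountable T𝒢 R𝒢 w𝒢) (fun n => (D𝒢.projAut h39𝒢.toProp36Hypotheses.isCountable n).ker) (fun _ => MonoidHom.normal_ker _)
        (D𝒢.hKst_and_hLst_of_ker_piLevelAut_eq_charOpenCore h39𝒢.toProp36Hypotheses.isCountable hconn𝒢 T𝒢 R𝒢 ρ𝒢 (isArithCompatible_piPresentation_outerAction_of_branchPair_chart_of_finite D𝒢 h39𝒢.toProp36Hypotheses.isCountable hcof𝒢 h39𝒢.toProp36Hypotheses.isConnected hS𝒢 hfin𝒢 hne𝒢 T𝒢 R𝒢 ρ𝒢 baseAct𝒢 h39𝒢.thm37Hypotheses h39𝒢.isGraph hV𝒢 hBR𝒢) d𝒢 hker𝒢).1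
        (D𝒢.ker_projAut_anti h39𝒢.toProp36Hypotheses.isCountable) (D𝒢.isOpen_ker_projAut h39𝒢.toProp36Hypotheses.isCountable) (fun _ hU => D𝒢.exists_ker_projAut_subset h39𝒢.toProp36Hypotheses.isCountable hU)
        (D𝒢.hK1'_chart_of_eventually_congruenceContinuous h39𝒢.thm37Hypotheses hcof𝒢 h39𝒢.toProp36Hypotheses.isConnected hS𝒢 hfin𝒢 hne𝒢 T𝒢 R𝒢 hconn𝒢 ρ𝒢 baseAct𝒢
          (isArithCompatible_piPresentation_outerAction_of_branchPair_chart_of_finite D𝒢 h39𝒢.toProp36Hypotheses.isCountable hcof𝒢 h39𝒢.toProp36Hypotheses.isConnected hS𝒢 hfin𝒢 hne𝒢 T𝒢 R𝒢 ρ𝒢 baseAct𝒢 h39𝒢.thm37Hypotheses h39𝒢.isGraph hV𝒢 hBR𝒢)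
          d𝒢 hker𝒢 h39𝒢.isGraph n𝒢 hCC𝒢))
    (noSwitch𝒢 : NoBranchSwitching 𝒢.graph.edgeOf
      (fun (a : 𝔊.PA) (b : 𝒢.graph.Branch) => (baseAct𝒢 a).hom.branchMap b))
    -- (AI4″) via abc-iut-w4-d059's hcof-FREE producer: only the chart representatives read off the presentation remain
    (hRcV𝒢 : ∀ v, Rc𝒢.Hv v = (D𝒢.piPresentation h39𝒢.toProp36Hypotheses.isCountable T𝒢 R𝒢).H v)
    (hRcB𝒢 : ∀ b, Rc𝒢.Hb b = ((D𝒢.piPresentation h39𝒢.toProp36Hypotheses.isCountable T𝒢 R𝒢).M (𝒢.graph.edgeOf b)).map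
      (MulAut.conj ((D𝒢.piPresentation h39𝒢.toProp36Hypotheses.isCountable T𝒢 R𝒢).s b)).toMonoidHom)
    (hest𝒢 : IsTotallyArithEstranged (decompositionDataOfChart Rc𝒢 (toOuterSemidirectProduct ρ𝒢)) (outerSemidirectProductSnd ρ𝒢)) (hbot𝒢 : ¬ IsArithAmple (outerSemidirectProductSnd ρ𝒢) ⊥)
    -- ── the ℍ′ side: a cofinal Galois tower with characteristic levels, its chart, the outer model over `Π_{A′}` ──
    (h39ℋ : Cor39Hypotheses ℋ) (Dℋ : GaloisLevelData ℋ)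
    (hcofℋ : ∀ (X : CovObj ℋ), X.IsTempered → ∀ p : X.Point, ∃ i : ℕ, ∀ j, i ≤ j → (Dℋ.S j).Splits (X.component p))
    (hSℋ : ∀ n, (Dℋ.S n).Splits (Dℋ.S n)) (hfinℋ : ∀ n, (Dℋ.S n).IsFinite) (hneℋ : ∀ n, (Dℋ.S n).HasNonemptyFibres)
    (hconnℋ : ∀ (n : ℕ) (p q : (Dℋ.S n).Point), (Dℋ.S n).SameComponent p q)
    [Finite ℋ.graph.Vertex] [Finite ℋ.graph.Branch]
    [Finite ℋ.graph.Edge]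
    (ρℋ : ℍ.PA →* TopOut (Dℋ.chart h39ℋ.toProp36Hypotheses.isCountable hcofℋ h39ℋ.toProp36Hypotheses.isConnected hSℋ hfinℋ hneℋ).G) (baseActℋ : ℍ.PA →* Aut ℋ.graph)
    [instℋ : TopologicalSpace (outerSemidirectProduct ρℋ)]
    (Tℋ : ∀ w : ℋ.graph.Vertex, Dℋ.PointSeq h39ℋ.toProp36Hypotheses.isCountable w) (Rℋ : SemiGraph.RefBranches ℋ.graph)
    (Rcℋ : ChartRepresentatives (Dℋ.chart h39ℋ.toProp36Hypotheses.isCountable hcofℋ h39ℋ.toProp36Hypotheses.isConnected hSℋ hfinℋ hneℋ))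
    -- Prop 3.6 (iv) at `ρ_𝔾(a)` / Def 5.1 (i)(c): the DESIGN data of the outer model (abc-iut-w4-d082's currency)
    (hVℋ : ∀ (a : ℍ.PA) (v : ℋ.graph.Vertex) (H : Subgroup (Dℋ.chart h39ℋ.toProp36Hypotheses.isCountable hcofℋ h39ℋ.toProp36Hypotheses.isConnected hSℋ hfinℋ hneℋ).G), H ∈ verticialSubgroups (Dℋ.chart h39ℋ.toProp36Hypotheses.isCountable hcofℋ h39ℋ.toProp36Hypotheses.isConnected hSℋ hfinℋ hneℋ) v →
      ∃ φ : contMulAut (Dℋ.chart h39ℋ.toProp36Hypotheses.isCountable hcofℋ h39ℋ.toProp36Hypotheses.isConnected hSℋ hfinℋ hneℋ).G, TopOut.mk _ φ = ρℋ a ∧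
        H.map (φ : MulAut (Dℋ.chart h39ℋ.toProp36Hypotheses.isCountable hcofℋ h39ℋ.toProp36Hypotheses.isConnected hSℋ hfinℋ hneℋ).G).toMonoidHom ∈ verticialSubgroups (Dℋ.chart h39ℋ.toProp36Hypotheses.isCountable hcofℋ h39ℋ.toProp36Hypotheses.isConnected hSℋ hfinℋ hneℋ) ((baseActℋ a).hom.vertexMap v))
    (hEℋ : ∀ (a : ℍ.PA) (e : ℋ.graph.Edge) (K : Subgroup (Dℋ.chart h39ℋ.toProp36Hypotheses.isCountable hcofℋ h39ℋ.toProp36Hypotheses.isConnected hSℋ hfinℋ hneℋ).G), K ∈ edgeLikeSubgroups (Dℋ.chart h39ℋ.toProp36Hypotheses.isCountable hcofℋ h39ℋ.toProp36Hypotheses.isConnected hSℋ hfinℋ hneℋ) e →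
      ∃ φ : contMulAut (Dℋ.chart h39ℋ.toProp36Hypotheses.isCountable hcofℋ h39ℋ.toProp36Hypotheses.isConnected hSℋ hfinℋ hneℋ).G, TopOut.mk _ φ = ρℋ a ∧
        K.map (φ : MulAut (Dℋ.chart h39ℋ.toProp36Hypotheses.isCountable hcofℋ h39ℋ.toProp36Hypotheses.isConnected hSℋ hfinℋ hneℋ).G).toMonoidHom ∈ edgeLikeSubgroups (Dℋ.chart h39ℋ.toProp36Hypotheses.isCountable hcofℋ h39ℋ.toProp36Hypotheses.isConnected hSℋ hfinℋ hneℋ) ((baseActℋ a).hom.edgeMap e))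
    (hopenℋ : ∃ U : Subgroup ℍ.PA, IsOpen (U : Set ℍ.PA) ∧ ∀ a ∈ U,
      (∀ v, (baseActℋ a).hom.vertexMap v = v) ∧ (∀ e, (baseActℋ a).hom.edgeMap e = e) ∧
        ∀ b, (baseActℋ a).hom.branchMap b = b)
    (hBRℋ : ∀ (a : ℍ.PA) (b : ℋ.graph.Branch) (v : ℋ.graph.Vertex) (hb : ℋ.graph.abuts b = some v)
      (φ : ℋ.Gv v →ₜ* (Dℋ.chart h39ℋ.toProp36Hypotheses.isCountable hcofℋ h39ℋ.toProp36Hypotheses.isConnected hSℋ hfinℋ hneℋ).G), IsVerticialHom (Dℋ.chart h39ℋ.toProp36Hypotheses.isCountable hcofℋ h39ℋ.toProp36Hypotheses.isConnected hSℋ hfinℋ hneℋ) v φ →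
      ∃ Φ : contMulAut (Dℋ.chart h39ℋ.toProp36Hypotheses.isCountable hcofℋ h39ℋ.toProp36Hypotheses.isConnected hSℋ hfinℋ hneℋ).G, TopOut.mk _ Φ = ρℋ a ∧
        ∃ φ' : ℋ.Gv ((baseActℋ a).hom.vertexMap v) →ₜ* (Dℋ.chart h39ℋ.toProp36Hypotheses.isCountable hcofℋ h39ℋ.toProp36Hypotheses.isConnected hSℋ hfinℋ hneℋ).G,
          IsVerticialHom (Dℋ.chart h39ℋ.toProp36Hypotheses.isCountable hcofℋ h39ℋ.toProp36Hypotheses.isConnected hSℋ hfinℋ hneℋ) ((baseActℋ a).hom.vertexMap v) φ' ∧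
          ∃ x' : (Dℋ.chart h39ℋ.toProp36Hypotheses.isCountable hcofℋ h39ℋ.toProp36Hypotheses.isConnected hSℋ hfinℋ hneℋ).G,
            Subgroup.map (Φ : MulAut (Dℋ.chart h39ℋ.toProp36Hypotheses.isCountable hcofℋ h39ℋ.toProp36Hypotheses.isConnected hSℋ hfinℋ hneℋ).G).toMonoidHom φ.toMonoidHom.range =
              Subgroup.map (MulAut.conj x').toMonoidHom φ'.toMonoidHom.range ∧
            Subgroup.map (Φ : MulAut (Dℋ.chart h39ℋ.toProp36Hypotheses.isCountable hcofℋ h39ℋ.toProp36Hypotheses.isConnected hSℋ hfinℋ hneℋ).G).toMonoidHom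
                (Subgroup.map φ.toMonoidHom (ℋ.branchSubgroup b v hb)) =
              Subgroup.map (MulAut.conj x').toMonoidHom
                (Subgroup.map φ'.toMonoidHom
                  (ℋ.branchSubgroup ((baseActℋ a).hom.branchMap b) ((baseActℋ a).hom.vertexMap v)
                    ((baseActℋ a).hom.abuts_branchMap b v hb))))
    (wℋ : ℋ.graph.Vertex)
    -- CHARACTERISTIC finite levels (abc-iut-L3-t9 E1): `ker π_n` is the characteristic open core of level `dℋ n`
    (dℋ : ℕ → ℕ) (hkerℋ : ∀ n, (Dℋ.piLevelAut h39ℋ.toProp36Hypotheses.isCountable hconnℋ n).ker = charOpenCore (Dℋ.temperedPi h39ℋ.toProp36Hypotheses.isCountable) (dℋ n))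
    -- (I0v) for the tower `Dℋ`: every `ℋ_v` acts faithfully on the `v`-fibres of the levels (abc-iut-w4-d053's
    -- `faithfulV_ofOpenNormalSeq` at the prescribed open-normal / characteristic tower)
    (hfaithVℋ : ∀ (v : ℋ.graph.Vertex) (h : ℋ.Gv v),
      (∀ (n : ℕ) (x : ((Dℋ.S n).SV v).obj.V), ((Dℋ.S n).SV v).obj.ρ h x = x) → h = 1)
    -- `hK1′` REPLACED (the L3 lead's α92 wording): congruence-continuity of `ρ` at the deep tree levels with trivial
    -- base action nearby (`hCC`, Def 5.1 (i)(c)/(d) + Prop 5.2 (i)); `hself` DISCHARGED (abc-iut-w6-d117 p442489)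
    (nℋ : ℕ)
    (hCCℋ : ∀ n, nℋ ≤ n → ∃ U ∈ 𝓝 (1 : ↥ℍ.PA), ∀ a ∈ U, baseActℋ a = 1 ∧
      ∃ φ : contMulAut (Dℋ.chart h39ℋ.toProp36Hypotheses.isCountable hcofℋ h39ℋ.toProp36Hypotheses.isConnected hSℋ hfinℋ hneℋ).G, TopOut.mk (Dℋ.chart h39ℋ.toProp36Hypotheses.isCountable hcofℋ h39ℋ.toProp36Hypotheses.isConnected hSℋ hfinℋ hneℋ).G φ = ρℋ a ∧
        ∀ y : (Dℋ.chart h39ℋ.toProp36Hypotheses.isCountable hcofℋ h39ℋ.toProp36Hypotheses.isConnected hSℋ hfinℋ hneℋ).G, (φ : MulAut (Dℋ.chart h39ℋ.toProp36Hypotheses.isCountable hcofℋ h39ℋ.toProp36Hypotheses.isConnected hSℋ hfinℋ hneℋ).G) y * y⁻¹ ∈ (Dℋ.projAut h39ℋ.toProp36Hypotheses.isCountable n).ker)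
    -- the topology of `E` IS abc-iut-w6-d070's tempered level topology at the chart of the tower
    (hinstℋ : instℋ = @arithLevelTopology ℋ (Dℋ.chart h39ℋ.toProp36Hypotheses.isCountable hcofℋ h39ℋ.toProp36Hypotheses.isConnected hSℋ hfinℋ hneℋ) ℍ.PA _ _ _ ρℋ baseActℋ
        (TemperedPiChart.firstCountableTopology_G (Dℋ.chart h39ℋ.toProp36Hypotheses.isCountable hcofℋ h39ℋ.toProp36Hypotheses.isConnected hSℋ hfinℋ hneℋ)) h39ℋ.toProp36Hypotheses IsTempered.of_profinite (Dℋ.piPresentation h39ℋ.toProp36Hypotheses.isCountable Tℋ Rℋ)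
        (isArithCompatible_piPresentation_outerAction_of_branchPair_chart_of_finite Dℋ h39ℋ.toProp36Hypotheses.isCountable hcofℋ h39ℋ.toProp36Hypotheses.isConnected hSℋ hfinℋ hneℋ Tℋ Rℋ ρℋ baseActℋ h39ℋ.thm37Hypotheses h39ℋ.isGraph hVℋ hBRℋ) wℋ
        (Dℋ.isCompact_piPresentation_H h39ℋ.toProp36Hypotheses.isCountable Tℋ Rℋ wℋ) (fun n => (Dℋ.projAut h39ℋ.toProp36Hypotheses.isCountable n).ker) (fun _ => MonoidHom.normal_ker _)
        (Dℋ.hKst_and_hLst_of_ker_piLevelAut_eq_charOpenCore h39ℋ.toProp36Hypotheses.isCountable hconnℋ Tℋ Rℋ ρℋ (isArithCompatible_piPresentation_outerAction_of_branchPair_chart_of_finite Dℋ h39ℋ.toProp36Hypotheses.isCountable hcofℋ h39ℋ.toProp36Hypotheses.isConnected hSℋ hfinℋ hneℋ Tℋ Rℋ ρℋ baseActℋ h39ℋ.thm37Hypotheses h39ℋ.isGraph hVℋ hBRℋ) dℋ hkerℋ).1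
        (Dℋ.ker_projAut_anti h39ℋ.toProp36Hypotheses.isCountable) (Dℋ.isOpen_ker_projAut h39ℋ.toProp36Hypotheses.isCountable) (fun _ hU => Dℋ.exists_ker_projAut_subset h39ℋ.toProp36Hypotheses.isCountable hU)
        (Dℋ.hK1'_chart_of_eventually_congruenceContinuous h39ℋ.thm37Hypotheses hcofℋ h39ℋ.toProp36Hypotheses.isConnected hSℋ hfinℋ hneℋ Tℋ Rℋ hconnℋ ρℋ baseActℋ
          (isArithCompatible_piPresentation_outerAction_of_branchPair_chart_of_finite Dℋ h39ℋ.toProp36Hypotheses.isCountable hcofℋ h39ℋ.toProp36Hypotheses.isConnected hSℋ hfinℋ hneℋ Tℋ Rℋ ρℋ baseActℋ h39ℋ.thm37Hypotheses h39ℋ.isGraph hVℋ hBRℋ)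
          dℋ hkerℋ h39ℋ.isGraph nℋ hCCℋ))
    (noSwitchℋ : NoBranchSwitching ℋ.graph.edgeOf
      (fun (a : ℍ.PA) (b : ℋ.graph.Branch) => (baseActℋ a).hom.branchMap b))
    -- (AI4″) via abc-iut-w4-d059's hcof-FREE producer: only the chart representatives read off the presentation remain
    (hRcVℋ : ∀ v, Rcℋ.Hv v = (Dℋ.piPresentation h39ℋ.toProp36Hypotheses.isCountable Tℋ Rℋ).H v)
    (hRcBℋ : ∀ b, Rcℋ.Hb b = ((Dℋ.piPresentation h39ℋ.toProp36Hypotheses.isCountable Tℋ Rℋ).M (ℋ.graph.edgeOf b)).map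
      (MulAut.conj ((Dℋ.piPresentation h39ℋ.toProp36Hypotheses.isCountable Tℋ Rℋ).s b)).toMonoidHom)
    (hestℋ : IsTotallyArithEstranged (decompositionDataOfChart Rcℋ (toOuterSemidirectProduct ρℋ)) (outerSemidirectProductSnd ρℋ)) (hbotℋ : ¬ IsArithAmple (outerSemidirectProductSnd ρℋ) ⊥)
    -- ── Thm 5.4 (iii): the arithmetic `B^temp`, the dictionary, the represented graph actions (design) ──
    -- (D1)/(D2): the dictionary of arrows with chosen 2-cells and its chart-level representatives (verbatim)
    (dict : (𝔊.G ⟶ ℍ.G) → Hom 𝒢 ℋ) (θd : ∀ g, (dict g).ConjugatorFamily) (hlo : ∀ g, (dict g).IsLocallyOpen)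
    (φc : (𝔊.G ⟶ ℍ.G) → ((D𝒢.chart h39𝒢.toProp36Hypotheses.isCountable hcof𝒢 h39𝒢.toProp36Hypotheses.isConnected hS𝒢 hfin𝒢 hne𝒢).G →ₜ* (Dℋ.chart h39ℋ.toProp36Hypotheses.isCountable hcofℋ h39ℋ.toProp36Hypotheses.isConnected hSℋ hfinℋ hneℋ).G))
    (hφc : ∀ g, Nonempty ((dict g).chartPullbackWith (θd g) (D𝒢.chart h39𝒢.toProp36Hypotheses.isCountable hcof𝒢 h39𝒢.toProp36Hypotheses.isConnected hS𝒢 hfin𝒢 hne𝒢) (Dℋ.chart h39ℋ.toProp36Hypotheses.isCountable hcofℋ h39ℋ.toProp36Hypotheses.isConnected hSℋ hfinℋ hneℋ) ≅ BTemp.res (φc g)))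
    (hfaith : ∀ g₁ g₂ : 𝔊.G ⟶ ℍ.G, Nonempty ((dict g₁).chartPullbackWith (θd g₁) (D𝒢.chart h39𝒢.toProp36Hypotheses.isCountable hcof𝒢 h39𝒢.toProp36Hypotheses.isConnected hS𝒢 hfin𝒢 hne𝒢) (Dℋ.chart h39ℋ.toProp36Hypotheses.isCountable hcofℋ h39ℋ.toProp36Hypotheses.isConnected hSℋ hfinℋ hneℋ) ≅
      (dict g₂).chartPullbackWith (θd g₂) (D𝒢.chart h39𝒢.toProp36Hypotheses.isCountable hcof𝒢 h39𝒢.toProp36Hypotheses.isConnected hS𝒢 hfin𝒢 hne𝒢) (Dℋ.chart h39ℋ.toProp36Hypotheses.isCountable hcofℋ h39ℋ.toProp36Hypotheses.isConnected hSℋ hfinℋ hneℋ)) → g₁ = g₂)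
    (hfull : ∀ F : Hom 𝒢 ℋ, F.IsLocallyOpen → ∀ θ : F.ConjugatorFamily,
      ∃ g : 𝔊.G ⟶ ℍ.G, Nonempty ((dict g).chartPullbackWith (θd g) (D𝒢.chart h39𝒢.toProp36Hypotheses.isCountable hcof𝒢 h39𝒢.toProp36Hypotheses.isConnected hS𝒢 hfin𝒢 hne𝒢) (Dℋ.chart h39ℋ.toProp36Hypotheses.isCountable hcofℋ h39ℋ.toProp36Hypotheses.isConnected hSℋ hfinℋ hneℋ) ≅ F.chartPullbackWith θ (D𝒢.chart h39𝒢.toProp36Hypotheses.isCountable hcof𝒢 h39𝒢.toProp36Hypotheses.isConnected hS𝒢 hfin𝒢 hne𝒢) (Dℋ.chart h39ℋ.toProp36Hypotheses.isCountable hcofℋ h39ℋ.toProp36Hypotheses.isConnected hSℋ hfinℋ hneℋ)))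
    -- (D1a)/(D1b): the graph actions of `Π_A` on `𝔾` and of `Π_{A′}` on `ℍ′` with chosen 2-cells, REPRESENTED at
    -- the outer actions (abc-iut-w5-d141's `hrep` currency), and the functoriality of the dictionary
    (F𝒢 : 𝔊.PA → Hom 𝒢 𝒢) (θ𝒢 : ∀ a, (F𝒢 a).ConjugatorFamily)
    (hrep𝒢 : ∀ a, ∃ (Φ : contMulAut (D𝒢.chart h39𝒢.toProp36Hypotheses.isCountable hcof𝒢 h39𝒢.toProp36Hypotheses.isConnected hS𝒢 hfin𝒢 hne𝒢).G) (φ : (D𝒢.chart h39𝒢.toProp36Hypotheses.isCountable hcof𝒢 h39𝒢.toProp36Hypotheses.isConnected hS𝒢 hfin𝒢 hne𝒢).G →ₜ* (D𝒢.chart h39𝒢.toProp36Hypotheses.isCountable hcof𝒢 h39𝒢.toProp36Hypotheses.isConnected hS𝒢 hfin𝒢 hne𝒢).G), TopOut.mk (D𝒢.chart h39𝒢.toProp36Hypotheses.isCountable hcof𝒢 h39𝒢.toProp36Hypotheses.isConnected hS𝒢 hfin𝒢 hne𝒢).G Φ = ρ𝒢 a ∧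
      (∀ t, (Φ : MulAut (D𝒢.chart h39𝒢.toProp36Hypotheses.isCountable hcof𝒢 h39𝒢.toProp36Hypotheses.isConnected hS𝒢 hfin𝒢 hne𝒢).G) t = φ t) ∧ Nonempty ((F𝒢 a).chartPullbackWith (θ𝒢 a) (D𝒢.chart h39𝒢.toProp36Hypotheses.isCountable hcof𝒢 h39𝒢.toProp36Hypotheses.isConnected hS𝒢 hfin𝒢 hne𝒢) (D𝒢.chart h39𝒢.toProp36Hypotheses.isCountable hcof𝒢 h39𝒢.toProp36Hypotheses.isConnected hS𝒢 hfin𝒢 hne𝒢) ≅ BTemp.res φ))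
    (hpre : ∀ (a : 𝔊.PA) (g : 𝔊.G ⟶ ℍ.G),
      Nonempty ((dict ((𝔊.ρ a).hom ≫ g)).chartPullbackWith (θd ((𝔊.ρ a).hom ≫ g)) (D𝒢.chart h39𝒢.toProp36Hypotheses.isCountable hcof𝒢 h39𝒢.toProp36Hypotheses.isConnected hS𝒢 hfin𝒢 hne𝒢) (Dℋ.chart h39ℋ.toProp36Hypotheses.isCountable hcofℋ h39ℋ.toProp36Hypotheses.isConnected hSℋ hfinℋ hneℋ) ≅
        (dict g).chartPullbackWith (θd g) (D𝒢.chart h39𝒢.toProp36Hypotheses.isCountable hcof𝒢 h39𝒢.toProp36Hypotheses.isConnected hS𝒢 hfin𝒢 hne𝒢) (Dℋ.chart h39ℋ.toProp36Hypotheses.isCountable hcofℋ h39ℋ.toProp36Hypotheses.isConnected hSℋ hfinℋ hneℋ) ⋙ (F𝒢 a).chartPullbackWith (θ𝒢 a) (D𝒢.chart h39𝒢.toProp36Hypotheses.isCountable hcof𝒢 h39𝒢.toProp36Hypotheses.isConnected hS𝒢 hfin𝒢 hne𝒢) (D𝒢.chart h39𝒢.toProp36Hypotheses.isCountable hcof𝒢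 h39𝒢.toProp36Hypotheses.isConnected hS𝒢 hfin𝒢 hne𝒢)))
    (Fℋ : ℍ.PA → Hom ℋ ℋ) (θℋ : ∀ a, (Fℋ a).ConjugatorFamily)
    (hrepℋ : ∀ a, ∃ (Φ : contMulAut (Dℋ.chart h39ℋ.toProp36Hypotheses.isCountable hcofℋ h39ℋ.toProp36Hypotheses.isConnected hSℋ hfinℋ hneℋ).G) (φ : (Dℋ.chart h39ℋ.toProp36Hypotheses.isCountable hcofℋ h39ℋ.toProp36Hypotheses.isConnected hSℋ hfinℋ hneℋ).G →ₜ* (Dℋ.chart h39ℋ.toProp36Hypotheses.isCountable hcofℋ h39ℋ.toProp36Hypotheses.isConnected hSℋ hfinℋ hneℋ).G), TopOut.mk (Dℋ.chart h39ℋ.toProp36Hypotheses.isCountable hcofℋ h39ℋ.toProp36Hypotheses.isConnected hSℋ hfinℋ hneℋ).G Φ = ρℋ a ∧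
      (∀ t, (Φ : MulAut (Dℋ.chart h39ℋ.toProp36Hypotheses.isCountable hcofℋ h39ℋ.toProp36Hypotheses.isConnected hSℋ hfinℋ hneℋ).G) t = φ t) ∧ Nonempty ((Fℋ a).chartPullbackWith (θℋ a) (Dℋ.chart h39ℋ.toProp36Hypotheses.isCountable hcofℋ h39ℋ.toProp36Hypotheses.isConnected hSℋ hfinℋ hneℋ) (Dℋ.chart h39ℋ.toProp36Hypotheses.isCountable hcofℋ h39ℋ.toProp36Hypotheses.isConnected hSℋ hfinℋ hneℋ) ≅ BTemp.res φ))
    (hpost : ∀ (a : ℍ.PA) (g : 𝔊.G ⟶ ℍ.G),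
      Nonempty ((dict (g ≫ (ℍ.ρ a).hom)).chartPullbackWith (θd (g ≫ (ℍ.ρ a).hom)) (D𝒢.chart h39𝒢.toProp36Hypotheses.isCountable hcof𝒢 h39𝒢.toProp36Hypotheses.isConnected hS𝒢 hfin𝒢 hne𝒢) (Dℋ.chart h39ℋ.toProp36Hypotheses.isCountable hcofℋ h39ℋ.toProp36Hypotheses.isConnected hSℋ hfinℋ hneℋ) ≅
        (Fℋ a).chartPullbackWith (θℋ a) (Dℋ.chart h39ℋ.toProp36Hypotheses.isCountable hcofℋ h39ℋ.toProp36Hypotheses.isConnected hSℋ hfinℋ hneℋ) (Dℋ.chart h39ℋ.toProp36Hypotheses.isCountable hcofℋ h39ℋ.toProp36Hypotheses.isConnected hSℋ hfinℋ hneℋ) ⋙ (dict g).chartPullbackWith (θd g) (D𝒢.chart h39𝒢.toProp36Hypotheses.isCountable hcof𝒢 h39𝒢.toProp36Hypotheses.isConnected hS𝒢 hfin𝒢 hne𝒢) (Dℋ.chart h39ℋ.toProp36Hypotheses.isCountable hcofℋ h39ℋ.toProp36Hypotheses.isConnected hSℋ hfinℋ hneℋ)))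
    -- arbitrary representatives on the `ℋ′` side (abc-iut-w4-d059's Rc-invariance): the decomposition data for Thm 5.4 (i)(ii) there
    (Rc'ℋ : ChartRepresentatives (Dℋ.chart h39ℋ.toProp36Hypotheses.isCountable hcofℋ h39ℋ.toProp36Hypotheses.isConnected hSℋ hfinℋ hneℋ))
    -- ── THE ONE DISPLAYED HYPOTHESIS of this row: no literally arithmetically quasi-geometric `f` over `A^⊤` COLLAPSES an
    -- arithmetically ample pair of distinct arithmetically maximal compact subgroups (the arithmetic shadow of the fold) ──
    (hdist : ∀ f : outerSemidirectProduct ρ𝒢 →* outerSemidirectProduct ρℋ,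
      IsArithQuasiGeometric (outerSemidirectProductSnd ρ𝒢) (e.symm.toMonoidHom.comp (outerSemidirectProductSnd ρℋ)) f →
      ∀ K₁ H₁ : Subgroup (outerSemidirectProduct ρ𝒢), IsArithMaximalCompact (outerSemidirectProductSnd ρ𝒢) K₁ →
        IsArithMaximalCompact (outerSemidirectProductSnd ρ𝒢) H₁ → K₁ ≠ H₁ →
        IsArithAmple (outerSemidirectProductSnd ρ𝒢) (K₁ ⊓ H₁) →
        ∀ M : Subgroup (outerSemidirectProduct ρℋ), IsArithMaximalCompact (outerSemidirectProductSnd ρℋ) M →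
          K₁.map f ≤ M → H₁.map f ≤ M → False)
    (he : Continuous e) :
    Literature.AnabelianGeometry.SemiGraphs.ArithQuasiGeometricCorrespondenceStatement 𝔊 ℍ e
      (outerSemidirectProductSnd ρ𝒢) (outerSemidirectProductSnd ρℋ)
      (fun φ _ h₂ => outerSemidirectProductMap ρ𝒢 ρℋ e.toMonoidHom (φc φ.geom).toMonoidHom
        (compat_of_representatives ρ𝒢 ρℋ e.toMonoidHom (φc φ.geom).toMonoidHom
          (btemp_representatives_of_dict (D𝒢.chart h39𝒢.toProp36Hypotheses.isCountable hcof𝒢 h39𝒢.toProp36Hypotheses.isConnected hS𝒢 hfin𝒢 hne𝒢) (Dℋ.chart h39ℋ.toProp36Hypotheses.isCountable hcofℋ h39ℋ.toProp36Hypotheses.isConnected hSℋ hfinℋ hneℋ) ρ𝒢 ρℋ e.toMonoidHom F𝒢 θ𝒢 (fun a => Fℋ (e a)) (fun a => θℋ (e a))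
            hrep𝒢 (fun a => hrepℋ (e a)) dict θd φc hφc (fun a g => (𝔊.ρ a).hom ≫ g) (fun a g => g ≫ (ℍ.ρ (e a)).hom)
            hpre (fun a g => hpost (e a) g) φ.geom (fun a => (φ.compat a).trans (by rw [h₂ a]))))
        (centraliserFree_of_chartPullbackWith_iso h39𝒢.thm37Hypotheses h39ℋ.thm37Hypotheses (D𝒢.chart h39𝒢.toProp36Hypotheses.isCountable hcof𝒢 h39𝒢.toProp36Hypotheses.isConnected hS𝒢 hfin𝒢 hne𝒢) (Dℋ.chart h39ℋ.toProp36Hypotheses.isCountable hcofℋ h39ℋ.toProp36Hypotheses.isConnected hSℋ hfinℋ hneℋ) (dict φ.geom) (θd φ.geom) (hlo φ.geom) (φc φ.geom) (hφc φ.geom))) := by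
  -- the per-side terms pinned by the topology equation on the `𝔾` side (verbatim from v6)
  have hP𝒢' := isArithCompatible_piPresentation_outerAction_of_branchPair_chart_of_finite D𝒢 h39𝒢.toProp36Hypotheses.isCountable hcof𝒢 h39𝒢.toProp36Hypotheses.isConnected hS𝒢 hfin𝒢 hne𝒢 T𝒢 R𝒢 ρ𝒢 baseAct𝒢 h39𝒢.thm37Hypotheses h39𝒢.isGraph hV𝒢 hBR𝒢
  have hKL𝒢' := D𝒢.hKst_and_hLst_of_ker_piLevelAut_eq_charOpenCore h39𝒢.toProp36Hypotheses.isCountable hconn𝒢 T𝒢 R𝒢 ρ𝒢 hP𝒢' d𝒢 hker𝒢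
  have hK1𝒢' := D𝒢.hK1'_chart_of_eventually_congruenceContinuous h39𝒢.thm37Hypotheses hcof𝒢 h39𝒢.toProp36Hypotheses.isConnected hS𝒢 hfin𝒢 hne𝒢 T𝒢 R𝒢 hconn𝒢 ρ𝒢 baseAct𝒢
    hP𝒢' d𝒢 hker𝒢 h39𝒢.isGraph n𝒢 hCC𝒢
  have hcpt𝒢' := D𝒢.isCompact_piPresentation_H h39𝒢.toProp36Hypotheses.isCountable T𝒢 R𝒢 w𝒢
  haveI hfc𝒢 : FirstCountableTopology (D𝒢.chart h39𝒢.toProp36Hypotheses.isCountable hcof𝒢 h39𝒢.toProp36Hypotheses.isConnected hS𝒢 hfin𝒢 hne𝒢).G := TemperedPiChart.firstCountableTopology_G _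
  -- `E_𝒢` is Hausdorff for abc-iut-w6-d070's tempered level topology
  subst hinst𝒢
  letI : TopologicalSpace (outerSemidirectProduct ρ𝒢) := arithLevelTopology (D𝒢.chart h39𝒢.toProp36Hypotheses.isCountable hcof𝒢 h39𝒢.toProp36Hypotheses.isConnected hS𝒢 hfin𝒢 hne𝒢) ρ𝒢 baseAct𝒢 h39𝒢.toProp36Hypotheses IsTempered.of_profinite (D𝒢.piPresentation h39𝒢.toProp36Hypotheses.isCountable T𝒢 R𝒢) hP𝒢' w𝒢 hcpt𝒢'
      (fun n => (D𝒢.projAut h39𝒢.toProp36Hypotheses.isCountable n).ker) (fun _ => MonoidHom.normal_ker _) hKL𝒢'.1 (D𝒢.ker_projAut_anti h39𝒢.toProp36Hypotheses.isCountable)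
      (D𝒢.isOpen_ker_projAut h39𝒢.toProp36Hypotheses.isCountable) (fun _ hU => D𝒢.exists_ker_projAut_subset h39𝒢.toProp36Hypotheses.isCountable hU) hK1𝒢'
  haveI hT2 : T2Space (outerSemidirectProduct ρ𝒢) := arithLevelTopology_t2Space (D𝒢.chart h39𝒢.toProp36Hypotheses.isCountable hcof𝒢 h39𝒢.toProp36Hypotheses.isConnected hS𝒢 hfin𝒢 hne𝒢) ρ𝒢 baseAct𝒢 h39𝒢.toProp36Hypotheses IsTempered.of_profinite (D𝒢.piPresentation h39𝒢.toProp36Hypotheses.isCountable T𝒢 R𝒢) hP𝒢' w𝒢 hcpt𝒢'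
      (fun n => (D𝒢.projAut h39𝒢.toProp36Hypotheses.isCountable n).ker) (fun _ => MonoidHom.normal_ker _) hKL𝒢'.1 (D𝒢.ker_projAut_anti h39𝒢.toProp36Hypotheses.isCountable)
      (D𝒢.isOpen_ker_projAut h39𝒢.toProp36Hypotheses.isCountable) (fun _ hU => D𝒢.exists_ker_projAut_subset h39𝒢.toProp36Hypotheses.isCountable hU) hK1𝒢'
  -- `e` is an isomorphism of PROFINITE groups: its inverse is continuous too
  have he' : Continuous e.symm := he.continuous_symm_of_equiv_compact_to_t2 (f := e.toEquiv)
  have he'' : Continuous e.symm.symm := he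
  -- the integrated line v6: Thm 5.4 (i) ∧ (ii) on both sides, compatible (iii)
  have h6 := arithThm54_outerModels_chart_of_producers_anyRepresentatives_hcontFree h39𝒢 D𝒢 hcof𝒢 hS𝒢 hfin𝒢 hne𝒢
    hconn𝒢 ρ𝒢 baseAct𝒢 T𝒢 R𝒢 Rc𝒢 hV𝒢 hE𝒢 hopen𝒢 hBR𝒢 w𝒢 d𝒢 hker𝒢 hfaithV𝒢 n𝒢 hCC𝒢 rfl noSwitch𝒢 hRcV𝒢 hRcB𝒢 hest𝒢
    hbot𝒢 h39ℋ Dℋ hcofℋ hSℋ hfinℋ hneℋ hconnℋ ρℋ baseActℋ Tℋ Rℋ Rcℋ hVℋ hEℋ hopenℋ hBRℋ wℋ dℋ hkerℋ hfaithVℋ nℋ hCCℋ hinstℋ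
    noSwitchℋ hRcVℋ hRcBℋ hestℋ hbotℋ dict θd hlo φc hφc hfaith hfull F𝒢 θ𝒢 hrep𝒢 hpre Fℋ θℋ hrepℋ hpost Rc𝒢 Rc'ℋ he
  -- Thm 5.4 (i) ∧ (ii) on the `ℋ′` side, transported along `e⁻¹` to the augmentation `e⁻¹ ∘ aug_ℋ` of the frozen statement
  have hI := (arithMaximalCompactStatementI_comp_mulEquiv_iff e.symm he' he''
    (decompositionDataOfChart Rc'ℋ (toOuterSemidirectProduct ρℋ)) (outerSemidirectProductSnd ρℋ)).mpr h6.2.1.1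
  have hII := (arithMaximalCompactStatementII_comp_mulEquiv_iff e.symm he' he''
    (decompositionDataOfChart Rc'ℋ (toOuterSemidirectProduct ρℋ)) (outerSemidirectProductSnd ρℋ)).mpr h6.2.1.2
  exact arithQuasiGeometricCorrespondenceStatement_of_compat_of_hdist h6.2.2 _ hI hII fun f hf K₁ H₁ hK₁ hH₁ hne ha M hM =>
    hdist f hf K₁ H₁ hK₁ hH₁ hne ha M ((isArithMaximalCompact_comp_mulEquiv_iff e.symm he' he'' _ M).mp hM)

end Literature.AnabelianGeometry.SemiGraphs
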